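import Summits.BirchSwinnertonDyer.Rank1Residual.ManinAdditive.ConwayCut
import Summits.BirchSwinnertonDyer.Rank1Residual.ManinAdditive.RamanujanCut
import Literature.NumberTheory.EllipticCurves.NewformsMainLemmaTraceProofs
import Literature.NumberTheory.EllipticCurves.ModularSymbolsHeckeProofs
import HarnessLib

/-!
# The translations `t = t_{1/2}` (`4 ∣ N`) and `R₃ = t_{1/3} + t_{2/3}` (`9 ∣ N`) on `S_k(Γ₀(N))` are single
# slashes: `(2 1; 0 2)` and `(3 j; 0 3)` normalise `Γ₀(N)`; at weight `2`, `(t f)(τ) = f(τ + ½)` and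
# `(R₃ f)(τ) = f(τ + ⅓) + f(τ + ⅔)`

Summit `BirchSwinnertonDyer`, route `ManinLocalTwoThree` (cell bsd-f2-manin), cruxes C2 `ManinOddAtFour`
(stmt-BirchSwinnertonDyer-22967) and C3 `ManinPrimeToThreeAtNine` (stmt-BirchSwinnertonDyer-22968): TOOL theorems for
desc's Conway cut (`Rank1Residual/ManinAdditive/ConwayCut.lean`, operator `halfTranslate`) and Ramanujan cut
(`…/RamanujanCut.lean`, operator `ramanujanThree`), whose support rows `ConwayDepthTransfer` / `RamanujanDepthTransfer`
are proved in the sibling file `ManinLocalTwoThreeDepthTransfer.lean`.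

* §1 `exists_mapGL_mul_eq_of_upper` — `(h j; 0 h) γ = γ' (h j; 0 h)` in `SL(2, ℤ)` for `h² ∣ c(γ)`, `h ∣ d − a`
  (explicit `γ'`, same lower-left entry); `dvd_entries_of_mem_Gamma0_four/_nine` — these divisibilities hold on
  `Γ₀(N)` for `h = 2`, `4 ∣ N` and `h = 3`, `9 ∣ N` (`ad ≡ 1 (mod h)` forces `a ≡ d`); hence
  `halfTranslateGL_mul_mul_inv_mem`, `thirdTranslateGL_mul_mul_inv_mem` (the matrices normalise `Γ₀(N)`) and
  `isDoubleCosetDecomp_of_normalises` (a normalising element is its own system of representatives);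
* §2 `coe_halfTranslate_eq_slash`, `coe_ramanujanThree_eq_slash` — the one-term formulas (tree
  `coe_cuspHeckeCorrespondence_eq_sum`), and at weight `2` (`(h j; 0 h) = diag(h,1)·diag(1,h)·(1 j/h; 0 1)`, the
  scalar matrix slashes trivially, tree `slash_tpD_mul_tpG`, `slash_upperRightHom_apply`):
  **`halfTranslate_two_apply`** `(t f)(τ) = f(½ +ᵥ τ)` and **`ramanujanThree_two_apply`**
  `(R₃ f)(τ) = f(⅓ +ᵥ τ) + f(⅔ +ᵥ τ)`.

No new definitions, no named fact, no sorry.  Nothing about BSD or Manin's conjecture is proved here.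

References: A. O. L. Atkin, J. Lehner, *Hecke operators on Γ₀(m)*, Math. Ann. 185 (1970), Lemma 27 and §4 (the
normaliser of `Γ₀(N)`) [cite: AtkinLehner1970, Lemma 27 and §4]; G. Shimura, *Introduction to the arithmetic theory of
automorphic functions* (1971), §3.4 (double coset operators); cell memo HOME/MEMO-desc.md §22 and refuter-1 §R53 P1/P7.
-/

set_option linter.dupNamespace false

noncomputable section

open scoped MatrixGroups ModularForm Real

open CongruenceSubgroup Matrix.SpecialLinearGroup UpperHalfPlane Complex Matrix.GeneralLinearGroup
  Literature.NumberTheory.EllipticCurves.ModularForms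
  Summit.BirchSwinnertonDyer.Rank1Residual.ManinAdditive
  Summit.BirchSwinnertonDyer.Rank1Residual.ManinAdditive.ConwayCut
  Summit.BirchSwinnertonDyer.Rank1Residual.ManinAdditive.RamanujanCut

namespace Summit.BirchSwinnertonDyer.BirchSwinnertonDyer.Theorems.ManinLocalTwoThree

/-! ### §1. The matrices `(h j; 0 h)` normalise `Γ₀(N)` for `h ∈ {2, 3}`, `h² ∣ N` -/

/-- **Conjugation by `(h j; 0 h)`**: for `γ = (a b; c d) ∈ SL(2, ℤ)` with `h² ∣ c` and `h ∣ d − a`,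
`(h j; 0 h) γ = γ' (h j; 0 h)` with `γ' = (a + jhc₁, b + je − j²c₁; c, d − jhc₁) ∈ SL(2, ℤ)`
(`c = h²c₁`, `d − a = he`), same lower-left entry. [cite: AtkinLehner1970, Lemma 27 and §4 (the normaliser of Γ₀(N))] -/
theorem exists_mapGL_mul_eq_of_upper {g : GL (Fin 2) ℝ} {h j : ℤ}
    (hg : ((g : GL (Fin 2) ℝ) : Matrix (Fin 2) (Fin 2) ℝ) = !![(h : ℝ), (j : ℝ); 0, (h : ℝ)])
    (γ : SL(2, ℤ)) {c₁ e : ℤ} (hc : γ 1 0 = h * h * c₁) (he : γ 1 1 - γ 0 0 = h * e) :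
    ∃ γ' : SL(2, ℤ), γ' 1 0 = γ 1 0 ∧ g * mapGL ℝ γ = mapGL ℝ γ' * g := by
  have hdet : γ 0 0 * γ 1 1 - γ 0 1 * γ 1 0 = 1 := by
    have := Matrix.det_fin_two (γ : Matrix (Fin 2) (Fin 2) ℤ)
    rw [γ.det_coe] at this
    linarith
  let γ' : SL(2, ℤ) := ⟨!![γ 0 0 + j * h * c₁, γ 0 1 + j * e - j * j * c₁; γ 1 0, γ 1 1 - j * h * c₁], by
    rw [Matrix.det_fin_two_of]
    linear_combination hdet + (j * j * c₁ - j * e) * hc + j * h * c₁ * he⟩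
  refine ⟨γ', rfl, ?_⟩
  ext i j'
  simp only [Units.val_mul, Matrix.mul_apply, Fin.sum_univ_two, hg]
  simp only [mapGL_coe_matrix, map_apply_coe, γ']
  have hc' : ((γ 1 0 : ℤ) : ℝ) = h * h * c₁ := by exact_mod_cast hc
  have he' : ((γ 1 1 : ℤ) : ℝ) = γ 0 0 + h * e := by
    have : (γ 1 1 : ℤ) = γ 0 0 + h * e := by linear_combination he
    exact_mod_cast this
  fin_cases i <;> fin_cases j' <;> simp [hc', he'] <;> ring

/-- For `γ ∈ Γ₀(N)` and `4 ∣ N`: `4 ∣ c` and `2 ∣ d − a` (`ad ≡ 1 (mod 2)`). -/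
theorem dvd_entries_of_mem_Gamma0_four {N : ℕ} (h4 : 4 ∣ N) {γ : SL(2, ℤ)} (hγ : γ ∈ Gamma0 N) :
    (∃ c₁ : ℤ, γ 1 0 = 2 * 2 * c₁) ∧ ∃ e : ℤ, γ 1 1 - γ 0 0 = 2 * e := by
  have hdet : γ 0 0 * γ 1 1 - γ 0 1 * γ 1 0 = 1 := by
    have := Matrix.det_fin_two (γ : Matrix (Fin 2) (Fin 2) ℤ)
    rw [γ.det_coe] at this
    linarith
  obtain ⟨c', hc⟩ : (N : ℤ) ∣ γ 1 0 := (ZMod.intCast_zmod_eq_zero_iff_dvd _ N).mp (Gamma0_mem.mp hγ)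
  obtain ⟨N₁, hN₁⟩ := h4
  refine ⟨⟨N₁ * c', by rw [hc, hN₁]; push_cast; ring⟩, ?_⟩
  have had : ((γ 0 0 : ℤ) : ZMod 2) * ((γ 1 1 : ℤ) : ZMod 2) = 1 := by
    have e : (γ 0 0 : ℤ) * γ 1 1 = 1 + 2 * (2 * N₁ * c' * γ 0 1) := by
      rw [hc, hN₁] at hdet; push_cast at hdet; linear_combination hdet
    have h2 := congrArg (fun z : ℤ ↦ (z : ZMod 2)) e
    push_cast at h2
    rw [h2, show (2 : ZMod 2) = 0 from rfl, zero_mul, add_zero]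
  have key : ∀ a d : ZMod 2, a * d = 1 → d - a = 0 := by decide
  have h0 : (((γ 1 1 - γ 0 0 : ℤ)) : ZMod 2) = 0 := by push_cast; exact key _ _ had
  exact (ZMod.intCast_zmod_eq_zero_iff_dvd _ 2).mp h0

/-- For `γ ∈ Γ₀(N)` and `9 ∣ N`: `9 ∣ c` and `3 ∣ d − a` (`ad ≡ 1 (mod 3)` forces `a ≡ d`). -/
theorem dvd_entries_of_mem_Gamma0_nine {N : ℕ} (h9 : 9 ∣ N) {γ : SL(2, ℤ)} (hγ : γ ∈ Gamma0 N) :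
    (∃ c₁ : ℤ, γ 1 0 = 3 * 3 * c₁) ∧ ∃ e : ℤ, γ 1 1 - γ 0 0 = 3 * e := by
  have hdet : γ 0 0 * γ 1 1 - γ 0 1 * γ 1 0 = 1 := by
    have := Matrix.det_fin_two (γ : Matrix (Fin 2) (Fin 2) ℤ)
    rw [γ.det_coe] at this
    linarith
  obtain ⟨c', hc⟩ : (N : ℤ) ∣ γ 1 0 := (ZMod.intCast_zmod_eq_zero_iff_dvd _ N).mp (Gamma0_mem.mp hγ)
  obtain ⟨N₁, hN₁⟩ := h9
  refine ⟨⟨N₁ * c', by rw [hc, hN₁]; push_cast; ring⟩, ?_⟩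
  have had : ((γ 0 0 : ℤ) : ZMod 3) * ((γ 1 1 : ℤ) : ZMod 3) = 1 := by
    have e : (γ 0 0 : ℤ) * γ 1 1 = 1 + 3 * (3 * N₁ * c' * γ 0 1) := by
      rw [hc, hN₁] at hdet; push_cast at hdet; linear_combination hdet
    have h3 := congrArg (fun z : ℤ ↦ (z : ZMod 3)) e
    push_cast at h3
    rw [h3, show (3 : ZMod 3) = 0 from rfl, zero_mul, add_zero]
  have key : ∀ a d : ZMod 3, a * d = 1 → d - a = 0 := by decide
  have h0 : (((γ 1 1 - γ 0 0 : ℤ)) : ZMod 3) = 0 := by push_cast; exact key _ _ had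
  exact (ZMod.intCast_zmod_eq_zero_iff_dvd _ 3).mp h0

/-- The real matrix of `halfTranslateGL` is `(2 1; 0 2)`. -/
theorem val_glCast_halfTranslateGL :
    ((glCast (halfTranslateGL : GL (Fin 2) ℚ) : GL (Fin 2) ℝ) : Matrix (Fin 2) (Fin 2) ℝ) =
      !![((2 : ℤ) : ℝ), ((1 : ℤ) : ℝ); 0, ((2 : ℤ) : ℝ)] := by
  ext i j
  fin_cases i <;> fin_cases j <;> simp [halfTranslateGL, glCast, Matrix.GeneralLinearGroup.mkOfDetNeZero]

/-- The real matrix of `thirdTranslateGL j` is `(3 j; 0 3)`. -/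
theorem val_glCast_thirdTranslateGL (j : ℕ) :
    ((glCast (thirdTranslateGL j : GL (Fin 2) ℚ) : GL (Fin 2) ℝ) : Matrix (Fin 2) (Fin 2) ℝ) =
      !![((3 : ℤ) : ℝ), ((j : ℤ) : ℝ); 0, ((3 : ℤ) : ℝ)] := by
  ext i j'
  fin_cases i <;> fin_cases j' <;> simp [thirdTranslateGL, glCast, Matrix.GeneralLinearGroup.mkOfDetNeZero]

/-- **`(2 1; 0 2)` normalises `Γ₀(N)` for `4 ∣ N`.** [cite: AtkinLehner1970, Lemma 27] -/
theorem halfTranslateGL_mul_mul_inv_mem {N : ℕ} (h4 : 4 ∣ N) {x : GL (Fin 2) ℝ}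
    (hx : x ∈ (Gamma0 N : Subgroup (GL (Fin 2) ℝ))) :
    glCast (halfTranslateGL : GL (Fin 2) ℚ) * x * (glCast (halfTranslateGL : GL (Fin 2) ℚ))⁻¹ ∈
      (Gamma0 N : Subgroup (GL (Fin 2) ℝ)) := by
  obtain ⟨γ, hγ, rfl⟩ := Subgroup.mem_map.mp hx
  obtain ⟨⟨c₁, hc⟩, e, he⟩ := dvd_entries_of_mem_Gamma0_four h4 hγ
  obtain ⟨γ', h10, hconj⟩ := exists_mapGL_mul_eq_of_upper val_glCast_halfTranslateGL γ hc he
  rw [hconj, mul_inv_cancel_right]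
  refine Subgroup.mem_map_of_mem _ ?_
  rw [Gamma0_mem, h10]
  exact Gamma0_mem.mp hγ

/-- **`(3 j; 0 3)` normalises `Γ₀(N)` for `9 ∣ N`.** [cite: AtkinLehner1970, Lemma 27] -/
theorem thirdTranslateGL_mul_mul_inv_mem {N : ℕ} (h9 : 9 ∣ N) (j : ℕ) {x : GL (Fin 2) ℝ}
    (hx : x ∈ (Gamma0 N : Subgroup (GL (Fin 2) ℝ))) :
    glCast (thirdTranslateGL j : GL (Fin 2) ℚ) * x * (glCast (thirdTranslateGL j : GL (Fin 2) ℚ))⁻¹ ∈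
      (Gamma0 N : Subgroup (GL (Fin 2) ℝ)) := by
  obtain ⟨γ, hγ, rfl⟩ := Subgroup.mem_map.mp hx
  obtain ⟨⟨c₁, hc⟩, e, he⟩ := dvd_entries_of_mem_Gamma0_nine h9 hγ
  obtain ⟨γ', h10, hconj⟩ := exists_mapGL_mul_eq_of_upper (val_glCast_thirdTranslateGL j) γ hc he
  rw [hconj, mul_inv_cancel_right]
  refine Subgroup.mem_map_of_mem _ ?_
  rw [Gamma0_mem, h10]
  exact Gamma0_mem.mp hγ

/-- A normalising element is by itself a system of representatives of its double coset. -/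
theorem isDoubleCosetDecomp_of_normalises {N : ℕ} {g : GL (Fin 2) ℚ}
    (hnorm : ∀ x ∈ (Gamma0 N : Subgroup (GL (Fin 2) ℝ)),
      glCast g * x * (glCast g)⁻¹ ∈ (Gamma0 N : Subgroup (GL (Fin 2) ℝ))) :
    IsDoubleCosetDecomp (Gamma0 N : Subgroup (GL (Fin 2) ℝ)) (Gamma0 N : Subgroup (GL (Fin 2) ℝ))
      (glCast g) (fun _ : Unit ↦ glCast g) where
  mem _ := DoubleCoset.mem_doubleCoset.mpr ⟨1, one_mem _, 1, one_mem _, by simp⟩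
  existsUnique x hx := by
    refine ⟨(), ?_, fun _ _ ↦ rfl⟩
    obtain ⟨γ, hγ, γ', hγ', rfl⟩ := DoubleCoset.mem_doubleCoset.mp hx
    have : γ * glCast g * γ' * (glCast g)⁻¹ = γ * (glCast g * γ' * (glCast g)⁻¹) := by group
    rw [this]
    exact mul_mem hγ (hnorm _ hγ')

/-! ### §2. The operators as single slashes; pointwise formulas at weight `2` -/

section Operators

variable {N : ℕ} [NeZero N]

/-- **One-term formula for `t`** (`4 ∣ N`): `t f = 4^{1−k/2} • (f ∣[k] (2 1; 0 2))` as functions on `ℍ`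
(the double coset of a normalising element is a single coset). [cite: AtkinLehner1970, Lemma 27] -/
theorem coe_halfTranslate_eq_slash (h4 : 4 ∣ N) {k : ℤ} (f : CuspForm (Gamma0 N) k) :
    (⇑(halfTranslate N k f) : ℍ → ℂ) =
      (((4 : ℝ) ^ (1 - (k : ℝ) / 2) : ℝ) : ℂ) • (⇑f ∣[k] glCast (halfTranslateGL : GL (Fin 2) ℚ)) := by
  have h := coe_cuspHeckeCorrespondence_eq_sum (Gamma0 N) (Gamma0 N) k (halfTranslateGL : GL (Fin 2) ℚ)
    (isDoubleCosetDecomp_of_normalises fun x hx ↦ halfTranslateGL_mul_mul_inv_mem h4 hx) f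
  rw [Fintype.sum_unique] at h
  unfold halfTranslate
  rw [LinearMap.smul_apply, CuspForm.IsGLPos.coe_smul]
  congr 1

/-- **One-term formula for `R₃`** (`9 ∣ N`): `R₃ f = 9^{1−k/2} • (f ∣[k] (3 1; 0 3) + f ∣[k] (3 2; 0 3))`.
[cite: AtkinLehner1970, Lemma 27] -/
theorem coe_ramanujanThree_eq_slash (h9 : 9 ∣ N) {k : ℤ} (f : CuspForm (Gamma0 N) k) :
    (⇑(ramanujanThree N k f) : ℍ → ℂ) =
      (((9 : ℝ) ^ (1 - (k : ℝ) / 2) : ℝ) : ℂ) •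
        (⇑f ∣[k] glCast (thirdTranslateGL 1 : GL (Fin 2) ℚ) +
          ⇑f ∣[k] glCast (thirdTranslateGL 2 : GL (Fin 2) ℚ)) := by
  have h1 := coe_cuspHeckeCorrespondence_eq_sum (Gamma0 N) (Gamma0 N) k (thirdTranslateGL 1 : GL (Fin 2) ℚ)
    (isDoubleCosetDecomp_of_normalises fun x hx ↦ thirdTranslateGL_mul_mul_inv_mem h9 1 hx) f
  have h2 := coe_cuspHeckeCorrespondence_eq_sum (Gamma0 N) (Gamma0 N) k (thirdTranslateGL 2 : GL (Fin 2) ℚ)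
    (isDoubleCosetDecomp_of_normalises fun x hx ↦ thirdTranslateGL_mul_mul_inv_mem h9 2 hx) f
  rw [Fintype.sum_unique] at h1 h2
  unfold ramanujanThree
  rw [LinearMap.smul_apply, CuspForm.IsGLPos.coe_smul, LinearMap.add_apply, CuspForm.coe_add]
  congr 1
  exact congrArg₂ (· + ·) h1 h2

/-- `(h j; 0 h) = diag(h, 1) · diag(1, h) · (1 j/h; 0 1)` in `GL(2, ℝ)`. -/
private theorem glCast_eq_tpD_mul_tpG_mul_upperRightHom {g : GL (Fin 2) ℚ} (h : ℕ) [NeZero h] (j : ℤ)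
    (hg : ((glCast g : GL (Fin 2) ℝ) : Matrix (Fin 2) (Fin 2) ℝ) = !![((h : ℤ) : ℝ), (j : ℝ); 0, ((h : ℤ) : ℝ)]) :
    glCast g = tpD h * tpG h * upperRightHom ((j : ℝ) / h) := by
  have hh : (h : ℝ) ≠ 0 := by exact_mod_cast NeZero.ne h
  ext i j'
  rw [hg]
  simp only [Units.val_mul, Matrix.mul_apply, Fin.sum_univ_two, val_tpD, val_tpG]
  fin_cases i <;> fin_cases j' <;> simp [upperRightHom_apply, mul_div_cancel₀, hh]

/-- `(f ∣₂ (h j; 0 h))(τ) = f(τ + j/h)` (weight `2`: the scalar matrix `h · 1` slashes trivially). -/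
private theorem slash_two_upper_apply {g : GL (Fin 2) ℚ} (h : ℕ) [NeZero h] (j : ℤ)
    (hg : ((glCast g : GL (Fin 2) ℝ) : Matrix (Fin 2) (Fin 2) ℝ) = !![((h : ℤ) : ℝ), (j : ℝ); 0, ((h : ℤ) : ℝ)])
    (f : ℍ → ℂ) (τ : ℍ) :
    (f ∣[(2 : ℤ)] glCast g) τ = f (((j : ℝ) / h) +ᵥ τ) := by
  rw [glCast_eq_tpD_mul_tpG_mul_upperRightHom h j hg, SlashAction.slash_mul, slash_tpD_mul_tpG h 2 f,
    sub_self, zpow_zero, one_smul, slash_upperRightHom_apply]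

/-- **`(t f)(τ) = f(τ + ½)`** at weight `2`, `4 ∣ N`. [cite: AtkinLehner1970, §4] -/
theorem halfTranslate_two_apply (h4 : 4 ∣ N) (f : CuspForm (Gamma0 N) 2) (τ : ℍ) :
    halfTranslate N 2 f τ = f ((((1 : ℤ) : ℝ) / (2 : ℕ)) +ᵥ τ) := by
  have h := congrFun (coe_halfTranslate_eq_slash h4 f) τ
  rw [Pi.smul_apply, slash_two_upper_apply 2 1 val_glCast_halfTranslateGL, smul_eq_mul] at h
  rw [h]
  norm_num

/-- **`(R₃ f)(τ) = f(τ + ⅓) + f(τ + ⅔)`** at weight `2`, `9 ∣ N`. [cite: AtkinLehner1970, §4] -/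
theorem ramanujanThree_two_apply (h9 : 9 ∣ N) (f : CuspForm (Gamma0 N) 2) (τ : ℍ) :
    ramanujanThree N 2 f τ =
      f ((((1 : ℕ) : ℤ) / (3 : ℕ) : ℝ) +ᵥ τ) + f ((((2 : ℕ) : ℤ) / (3 : ℕ) : ℝ) +ᵥ τ) := by
  have h := congrFun (coe_ramanujanThree_eq_slash h9 f) τ
  rw [Pi.smul_apply, Pi.add_apply, slash_two_upper_apply 3 (1 : ℕ) (val_glCast_thirdTranslateGL 1),
    slash_two_upper_apply 3 (2 : ℕ) (val_glCast_thirdTranslateGL 2), smul_eq_mul] at h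
  rw [h]
  norm_num

end Operators

end Summit.BirchSwinnertonDyer.BirchSwinnertonDyer.Theorems.ManinLocalTwoThree

end
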